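import Summits.BirchSwinnertonDyer.BirchSwinnertonDyer.Theorems.KolyvaginDepthDoorKolyvaginDepthSupplyDoorOfDatumPrintTwist
import HarnessLib

/-!
# Route `KolyvaginDepthDoor`, crux `KolyvaginDepthSupply` (stmt-BirchSwinnertonDyer-21765) —
# THE DOOR ON THE OTHER SIGN: the crux's SECOND rank clause `ν(n) = rank E(ℚ) = rank E^{(d_K)}(ℚ) − 1`
# read "points first" — `t_p(E) = 0` AND `t_p(E^{(d_K)}) = 0` from one non-zero class of depth `ν`,
# `ν ≤ rank E(ℚ)` and `ν + 1 ≤ rank E^{(d_K)}(ℚ)` (no Kolyvagin Thm. 4)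

Helper file (`--supports stmt-BirchSwinnertonDyer-21765 --as helper`); it closes nothing and BSD is
not proved by it.

WHY. The crux `KolyvaginDepthSupply` has TWO rank clauses: `ν(n) + 1 = rank E(ℚ) > rank E^{(d_K)}(ℚ)`
(the larger eigenspace of `Sel_p(E/K)` under complex conjugation is the `+` one) and
`ν(n) = rank E(ℚ) = rank E^{(d_K)}(ℚ) − 1` (it is the `−` one — the only habitat of rank-`0` curves,
`ν = 0`). Every hF-free door of g5–g8 (`door_of_hypothesesDepth`, `…_of_datum…`,
`natCard_selmerGroup_twist_le_of_hypothesesDepth`) reads the FIRST clause only (`ν + 1 ≤ rank E(ℚ)`),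
and the planner-facing datum forms `KolyvaginDepthSupplyDatum` / `…System` kept only that clause —
which makes them false as stated (sibling file `…KolyvaginDepthSupplyDatumFalse`: a rank-`0` non-CM
curve). This file supplies the door for the SECOND clause, so that the repaired (signed) datum form
again reaches X1 on every non-CM curve WITHOUT Kolyvagin's structure theorem (`KolyvaginStructure`, XL).

HOW (Kolyvagin 1991 Thm. 2.3 as PROVED algebra, `KolyvaginDescent.HypothesesDepth`): one non-zero class
`c(n₁) ≠ 0` of depth `ν` gives SIGNED bounds `#Sel_p(E/K)^{e} ≤ p^{ν+1}`, `#Sel_p(E/K)^{−e} ≤ p^{ν}`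
for some sign `e` (`card_sel_le_of_ne_zero`). Gross's decomposition (5.1) at finite level, both halves
PROVED in the tree: `Sel_p(E/ℚ) ↪ Sel_p(E/K)^+` (`SelmerTorsionRestriction`) and
`Sel_p(E^{(d_K)}/ℚ) ↪ Sel_p(E/K)^−` (`SelmerTorsionTwistRestriction`). If `ν + 1 ≤ rank E^{(d_K)}(ℚ)`
then `#Sel_p(E^{(d_K)}/ℚ) ≥ p^{ν+1}` (descent count, Silverman X.4.2), so `e = −1`; hence
`#Sel_p(E/ℚ) ≤ p^{ν}`, and with `ν ≤ rank E(ℚ)` the exact count pins `rank E(ℚ) = ν`, `E(ℚ)[p] = 0`,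
`Ш(E/ℚ)[p] = 0`, so `corank_{ℤ_p} Ш(E/ℚ)[p^∞] = 0`; symmetrically `#Sel_p(E^{(d_K)}/ℚ) ≤ p^{ν+1}` pins
`rank E^{(d_K)}(ℚ) = ν + 1`, `Ш(E^{(d_K)}/ℚ)[p] = 0`, `corank_{ℤ_p} Ш(E^{(d_K)}/ℚ)[p^∞] = 0`.

* `door_of_hypothesesDepth_of_twist_rank` — the abstract statement (any `HypothesesDepth` `S` on
  `H¹(K, E[m])`, `m = p`, pinned to `Sel(E/K)`, `conjAct W c`, `p`).
* `shaCorank_eq_zero_of_kolyvaginClass_ne_zero_of_twist_rank_of_datum_of_hfin` — the door OF A DATUM on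
  the second clause, print-standard inputs ((γ) = `GrossLMS1991.prop37_2_frobeniusCongruence` through
  g8's `exists_hypothesesDepth_of_datum_of_hfin`; the finite local clause `hfin` displayed);
  `…_kodairaNeron` (on (γ) + the Kodaira–Néron side condition) and `…_gross1991E0` (on (γ) + F1 =
  `Gross1991_heegnerPoint_sub_ratTorsion_mem_E0`).

CONDITIONAL on the displayed hypotheses ((γ) [+ F1], the bit at ONE datum, the two rank inequalities
"points first"); per-curve; nothing class-wide is asserted; BSD is not proved by it.

References: [Kolyvagin1991MathAnn] V. A. Kolyvagin, Math. Ann. 291 (1991), Thm. 2.3 and Thm. 4;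
[GrossLMS1991] §5 (5.1), §10; [McCallumLMS1991] §§2–5; [SilvermanAEC2009] Thm. X.4.2;
[GrossZagier1986] III (3.1).
-/

set_option linter.dupNamespace false

noncomputable section

open scoped Classical

namespace Summit.BirchSwinnertonDyer.BirchSwinnertonDyer.Theorems.KolyvaginDepthDoor

open Literature.NumberTheory.EllipticCurves Literature.NumberTheory.EllipticCurves.ModularForms
  Literature.NumberTheory.EllipticCurves.KolyvaginDescent
  Literature.NumberTheory.EllipticCurves.McCallum1991 WeierstrassCurve NumberField IsDedekindDomain
open Literature.NumberTheory.DiophantineGeometry (KodairaSymbol)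

/-! ## §1 The abstract door on the second sign -/

/-- **The twist-side door from Kolyvagin's descent data (second rank clause of the crux).** `E/ℚ`
elliptic, `K` a quadratic number field with a non-trivial automorphism `c`, `p` an odd prime, `m = p`;
`S` minimal-depth descent data on `H¹(K, E[m])` with `S.Sel = Sel^(m)(E/K)`, `S.τ = conjAct W c m`,
`S.p = p`; `S.c n₁ ≠ 0` at a square-free product `n₁` of `S`-Kolyvagin primes with `ν` prime factors;
and — points first — `ν ≤ rank E(ℚ)`, `ν + 1 ≤ rank E^{(d_K)}(ℚ)`. Then
`corank_{ℤ_p} Ш(E/ℚ)[p^∞] = 0`, `rank E(ℚ) = ν`, `corank_{ℤ_p} Ш(E^{(d_K)}/ℚ)[p^∞] = 0`,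
`rank E^{(d_K)}(ℚ) = ν + 1`, `#E(ℚ)[p] = 1`, `Ш(E/ℚ)[p] = 0`, `#Sel_p(E/ℚ) = p^{ν}`,
`Ш(E^{(d_K)}/ℚ)[p] = 0`, `#Sel_p(E^{(d_K)}/ℚ) = p^{ν+1}`. Proof: Kolyvagin's signed bounds
(`card_sel_le_of_ne_zero`); the sign is `−` because `Sel_p(E^{(d_K)}/ℚ)` (order `≥ p^{ν+1}`) embeds
in `Sel_p(E/K)^−` (`natCard_selmerGroup_quadraticTwist_discr_le_of_forall_mem`); then
`Sel_p(E/ℚ) ↪ Sel_p(E/K)^+` (`natCard_selmerGroup_le_of_forall_mem_of_finrank_eq_two`) and the exact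
descent counts over `ℚ` (`rank_and_sha_of_natCard_selmerGroup_le`). NO structure theorem, NO point of
`E(K)` beyond the counted ranks. Conditional only on `S`; per-curve; BSD is not proved by it.
[cite: Kolyvagin1991MathAnn, Thm. 2.3] [cite: GrossLMS1991, §5 (5.1) and §10]
[cite: SilvermanAEC2009, Thm X.4.2] -/
theorem door_of_hypothesesDepth_of_twist_rank (W : WeierstrassCurve ℚ) [W.IsElliptic] (K : Type)
    [Field K] [NumberField K] (hK2 : Module.finrank ℚ K = 2) (c : K ≃ₐ[ℚ] K) (hc : c ≠ 1)
    (p : ℕ) [hp : Fact p.Prime] (hp2 : p ≠ 2) {m : ℕ} (hm : m = p) {Pl : Type*}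
    (S : HypothesesDepth (galH1Torsion (W.baseChange K) (m : ℤ)) Pl)
    (hSel : S.Sel = selmerGroup (W.baseChange K) (m : ℤ)) (hSp : S.p = p)
    (hSτ : S.τ = conjAct W c (m : ℤ))
    {n₁ : ℕ} (hn₁ : KolSupp S.Kol n₁) (hne : S.c n₁ ≠ 0)
    (hrank : n₁.primeFactors.card ≤ W.mordellWeilRank)
    (hrank' : n₁.primeFactors.card + 1 ≤ (W.quadraticTwist (NumberField.discr K : ℚ)).mordellWeilRank) :
    W.shaCorank p = 0 ∧ W.mordellWeilRank = n₁.primeFactors.card ∧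
      (W.quadraticTwist (NumberField.discr K : ℚ)).shaCorank p = 0 ∧
      (W.quadraticTwist (NumberField.discr K : ℚ)).mordellWeilRank = n₁.primeFactors.card + 1 ∧
      Nat.card ↥(AddSubgroup.torsionBy W.toAffine.Point (m : ℤ)) = 1 ∧
      W.sha ⊓ AddSubgroup.torsionBy W.galH1 (m : ℤ) = ⊥ ∧
      Nat.card ↥(selmerGroup W (m : ℤ)) = p ^ n₁.primeFactors.card ∧
      (W.quadraticTwist (NumberField.discr K : ℚ)).sha ⊓
          AddSubgroup.torsionBy (W.quadraticTwist (NumberField.discr K : ℚ)).galH1 (m : ℤ) = ⊥ ∧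
      Nat.card ↥(selmerGroup (W.quadraticTwist (NumberField.discr K : ℚ)) (m : ℤ)) =
        p ^ (n₁.primeFactors.card + 1) := by
  subst hm
  have hpP : m.Prime := hp.out
  set ν := n₁.primeFactors.card with hν
  have hdK : (NumberField.discr K : ℚ) ≠ 0 := by exact_mod_cast NumberField.discr_ne_zero K
  haveI := W.isElliptic_quadraticTwist hdK
  -- Kolyvagin's signed bounds at the minimal depth
  obtain ⟨-, -, e, he, hfinE, hcardE, hfinO, hcardO⟩ := S.card_sel_le_of_ne_zero hn₁ hne
  rw [hSp] at hcardE hcardO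
  -- eigen-membership of Selmer classes
  have hT1 : ∀ s ∈ selmerGroup (W.baseChange K) (m : ℤ), conjAct W c (m : ℤ) s = (1 : ℤ) • s →
      s ∈ S.eigenSel 1 := fun s hs hτ ↦ by
    rw [S.mem_eigenSel, hSel, hSτ]
    exact ⟨hs, hτ⟩
  have hTm : ∀ s ∈ selmerGroup (W.baseChange K) (m : ℤ), conjAct W c (m : ℤ) s = (-1 : ℤ) • s →
      s ∈ S.eigenSel (-1) := fun s hs hτ ↦ by
    rw [S.mem_eigenSel, hSel, hSτ]
    exact ⟨hs, hτ⟩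
  -- the sign is `-1`: otherwise `Sel_p(E^{(d_K)}/ℚ)` (order `≥ p^{ν+1}`) would sit in a group of
  -- order `≤ p^ν`
  have he1 : e = -1 := by
    rcases he with h | h
    · exfalso
      subst h
      haveI := hfinO
      obtain ⟨-, hleT⟩ := natCard_selmerGroup_quadraticTwist_discr_le_of_forall_mem W K hK2 c hc hpP
        hp2 (S.eigenSel (-1)) hTm
      obtain ⟨hr', -⟩ := rank_and_sha_of_natCard_selmerGroup_le
        (W.quadraticTwist (NumberField.discr K : ℚ)) hpP.one_lt ν (hleT.trans hcardO) (by omega)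
      omega
    · exact h
  subst he1
  rw [neg_neg] at hfinO hcardO
  haveI := hfinE
  haveI := hfinO
  -- the `+`-side over `ℚ`: `#Sel_p(E/ℚ) ≤ p^ν`, against `ν ≤ rank E(ℚ)`
  obtain ⟨-, hcardQ⟩ := natCard_selmerGroup_le_of_forall_mem_of_finrank_eq_two K W c hK2 hc hpP
    hp2 (S.eigenSel 1) hT1
  obtain ⟨hr, ht, hbot, hcardSel⟩ := rank_and_sha_of_natCard_selmerGroup_le W hpP.one_lt ν
    (hcardQ.trans hcardO) hrank
  have hsha : W.shaCorank m = 0 :=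
    shaCorank_eq_zero_of_sha_inf_torsionBy_eq_bot W m (dvd_refl m) hbot
  -- the `−`-side on the twist: `#Sel_p(E^{(d_K)}/ℚ) ≤ p^{ν+1}`, against `ν + 1 ≤ rank E^{(d_K)}(ℚ)`
  obtain ⟨-, hcardT⟩ := natCard_selmerGroup_quadraticTwist_discr_le_of_forall_mem W K hK2 c hc hpP
    hp2 (S.eigenSel (-1)) hTm
  obtain ⟨hr', -, hbot', hcardSel'⟩ := rank_and_sha_of_natCard_selmerGroup_le
    (W.quadraticTwist (NumberField.discr K : ℚ)) hpP.one_lt (ν + 1) (hcardT.trans hcardE) hrank'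
  have hsha' : (W.quadraticTwist (NumberField.discr K : ℚ)).shaCorank m = 0 :=
    shaCorank_eq_zero_of_sha_inf_torsionBy_eq_bot _ m (dvd_refl m) hbot'
  exact ⟨hsha, hr, hsha', hr', by convert ht, hbot, hcardSel, hbot', hcardSel'⟩

/-- **The crux's SECOND rank clause from the twist-side door**: in the setting of
`door_of_hypothesesDepth_of_twist_rank`, `ν = rank E(ℚ)` and `rank E^{(d_K)}(ℚ) = rank E(ℚ) + 1` — the
clause `(n.primeFactors.card = W.mordellWeilRank ∧ (W.quadraticTwist d_K).mordellWeilRank =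
W.mordellWeilRank + 1)` of `KolyvaginDepthSupply`, read off from the counted points.
[cite: Kolyvagin1991MathAnn, Thm. 2.3] [cite: GrossLMS1991, §5 (5.1) and §10] -/
theorem kolyvaginDepthSupply_rankClause_two_of_hypothesesDepth (W : WeierstrassCurve ℚ) [W.IsElliptic]
    (K : Type) [Field K] [NumberField K] (hK2 : Module.finrank ℚ K = 2) (c : K ≃ₐ[ℚ] K) (hc : c ≠ 1)
    (p : ℕ) [hp : Fact p.Prime] (hp2 : p ≠ 2) {m : ℕ} (hm : m = p) {Pl : Type*}
    (S : HypothesesDepth (galH1Torsion (W.baseChange K) (m : ℤ)) Pl)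
    (hSel : S.Sel = selmerGroup (W.baseChange K) (m : ℤ)) (hSp : S.p = p)
    (hSτ : S.τ = conjAct W c (m : ℤ))
    {n₁ : ℕ} (hn₁ : KolSupp S.Kol n₁) (hne : S.c n₁ ≠ 0)
    (hrank : n₁.primeFactors.card ≤ W.mordellWeilRank)
    (hrank' : n₁.primeFactors.card + 1 ≤ (W.quadraticTwist (NumberField.discr K : ℚ)).mordellWeilRank) :
    n₁.primeFactors.card = W.mordellWeilRank ∧
      (W.quadraticTwist (NumberField.discr K : ℚ)).mordellWeilRank = W.mordellWeilRank + 1 := by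
  obtain ⟨-, hr, -, hr', -⟩ := door_of_hypothesesDepth_of_twist_rank W K hK2 c hc p hp2 hm S hSel hSp
    hSτ hn₁ hne hrank hrank'
  exact ⟨hr.symm, by rw [hr', hr]⟩

/-! ## §2 The door OF A DATUM on the second sign, print-standard inputs -/

section Datum

variable {W : WeierstrassCurve ℚ} [W.IsElliptic] [W.IsGloballyMinimal] [NeZero (W.conductorNorm ℤ)]
  {K : Type} [Field K] [NumberField K]
  {Dt : ModularParametrizationData W (W.conductorNorm ℤ)} {β : ℤ} {ι : K →+* ℂ}

/-- **The door of a datum on the second sign, `hfin` displayed.** `E/ℚ` globally minimal without CM,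
`K` imaginary quadratic with `d_K ∉ {−3, −4}` and the Heegner hypothesis for `N_E`, `c` its complex
conjugation, `p` odd with `ρ̄_{E,p^n}` onto for all `n`, a frame `(Dt, β, ι)`; (γ) =
`GrossLMS1991.prop37_2_frobeniusCongruence` (Gross 1991 Prop. 3.7 (2); cite-only) and the finite local
clause `hfin` (`c_1(n)_v ∈ δ(E(K_v))` for `v ∤ n`, McCallum Lemma 4.3 — the Kodaira–Néron cell or F1
supply it, below). If ONE datum `d₁` of square-free conductor `n₁` with `ν` Zhang–Kolyvagin prime
factors has `c_1(n₁) ≠ 0`, and — points first — `ν ≤ rank E(ℚ)` and `ν + 1 ≤ rank E^{(d_K)}(ℚ)`,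
then `corank_{ℤ_p} Ш(E/ℚ)[p^∞] = 0`, `rank E(ℚ) = ν`, `corank_{ℤ_p} Ш(E^{(d_K)}/ℚ)[p^∞] = 0`,
`rank E^{(d_K)}(ℚ) = ν + 1`, `#E(ℚ)[p] = 1`, `Ш(E/ℚ)[p] = 0`, `#Sel_p(E/ℚ) = p^{ν}`,
`Ш(E^{(d_K)}/ℚ)[p] = 0`, `#Sel_p(E^{(d_K)}/ℚ) = p^{ν+1}` (g8's `exists_hypothesesDepth_of_datum_of_hfin`
fed to `door_of_hypothesesDepth_of_twist_rank`). CONDITIONAL on (γ) and `hfin`; per-curve; BSD is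
not proved by it. [cite: Kolyvagin1991MathAnn, Thm. 2.3] [cite: GrossLMS1991, Prop. 3.7 (2), §5 (5.1), §10]
[cite: McCallumLMS1991, §§2–5] -/
theorem shaCorank_eq_zero_of_kolyvaginClass_ne_zero_of_twist_rank_of_datum_of_hfin
    (h372 : GrossLMS1991.prop37_2_frobeniusCongruence)
    (hcm : ¬ W.HasCM) (hK : IsImaginaryQuadratic K) (hD3 : NumberField.discr K ≠ -3)
    (hD4 : NumberField.discr K ≠ -4) (hH : SatisfiesHeegnerHypothesis (W.conductorNorm ℤ) K)
    (p : ℕ) [hp : Fact p.Prime] (hp2 : p ≠ 2)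
    (htower : ∀ n : ℕ, W.HasSurjectiveModNGaloisRep (p ^ n : ℕ))
    (c : K ≃ₐ[ℚ] K) (hc : c ≠ 1) (hcc : c * c = 1)
    (hfin : ∀ (n : ℕ), Squarefree n →
      (∀ q ∈ n.primeFactors, Zhang2014.IsKolyvaginPrime (W.conductorNorm ℤ) W K p q) →
      ∀ (d : KolyvaginHeegnerData Dt β ι n) (v : HeightOneSpectrum (𝓞 K)), (n : 𝓞 K) ∉ v.asIdeal →
        d.kolyvaginClass hp.out 1 ∈ selmerLocalKer (W.baseChange K) (v.adicCompletion K) ((p ^ 1 : ℕ) : ℤ))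
    {n₁ : ℕ} (hn₁ : Squarefree n₁)
    (hk₁ : ∀ q ∈ n₁.primeFactors, Zhang2014.IsKolyvaginPrime (W.conductorNorm ℤ) W K p q)
    (d₁ : KolyvaginHeegnerData Dt β ι n₁) (hne : d₁.kolyvaginClass hp.out 1 ≠ 0)
    (hrank : n₁.primeFactors.card ≤ W.mordellWeilRank)
    (hrank' : n₁.primeFactors.card + 1 ≤ (W.quadraticTwist (NumberField.discr K : ℚ)).mordellWeilRank) :
    W.shaCorank p = 0 ∧ W.mordellWeilRank = n₁.primeFactors.card ∧
      (W.quadraticTwist (NumberField.discr K : ℚ)).shaCorank p = 0 ∧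
      (W.quadraticTwist (NumberField.discr K : ℚ)).mordellWeilRank = n₁.primeFactors.card + 1 ∧
      Nat.card ↥(AddSubgroup.torsionBy W.toAffine.Point ((p ^ 1 : ℕ) : ℤ)) = 1 ∧
      W.sha ⊓ AddSubgroup.torsionBy W.galH1 ((p ^ 1 : ℕ) : ℤ) = ⊥ ∧
      Nat.card ↥(selmerGroup W ((p ^ 1 : ℕ) : ℤ)) = p ^ n₁.primeFactors.card ∧
      (W.quadraticTwist (NumberField.discr K : ℚ)).sha ⊓
          AddSubgroup.torsionBy (W.quadraticTwist (NumberField.discr K : ℚ)).galH1 ((p ^ 1 : ℕ) : ℤ) = ⊥ ∧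
      Nat.card ↥(selmerGroup (W.quadraticTwist (NumberField.discr K : ℚ)) ((p ^ 1 : ℕ) : ℤ)) =
        p ^ (n₁.primeFactors.card + 1) := by
  obtain ⟨S, hSel, hSp, hSc, hSK, hSτ⟩ := exists_hypothesesDepth_of_datum_of_hfin h372 hcm hK hD3 hD4 hH p
    hp2 htower c hc hcc hfin hn₁ hk₁ d₁
  have hsupp : KolSupp S.Kol n₁ := by rw [hSK]; exact ⟨hn₁, hk₁⟩
  have hne' : S.c n₁ ≠ 0 := by rw [hSc]; exact hne
  exact door_of_hypothesesDepth_of_twist_rank W K hK.1 c hc p hp2 (pow_one p) S hSel hSp hSτ hsupp hne'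
    hrank hrank'

/-- **THE DOOR OF A DATUM ON THE SECOND SIGN, KODAIRA–NÉRON CELL**: as `…_of_hfin` with the finite
local clause PROVED on the Kodaira–Néron cell (`kolyvaginClass_mem_selmerLocalKer_finite_one_of_kodairaNeron`:
(KN_p) `p ∤ ord_v(Δ_min)` at every multiplicative place and — only when `p = 3` — no additive place of
type IV / IV*). CONDITIONAL on (γ) only; per-curve; BSD is not proved by it.
[cite: Kolyvagin1991MathAnn, Thm. 2.3] [cite: GrossLMS1991, Prop. 3.7 (2), Prop. 6.2 (1), §10]
[cite: SilvermanAEC2009, VII.6.1] -/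
theorem shaCorank_eq_zero_of_kolyvaginClass_ne_zero_of_twist_rank_of_datum_kodairaNeron
    (h372 : GrossLMS1991.prop37_2_frobeniusCongruence)
    (hcm : ¬ W.HasCM) (hK : IsImaginaryQuadratic K) (hD3 : NumberField.discr K ≠ -3)
    (hD4 : NumberField.discr K ≠ -4) (hH : SatisfiesHeegnerHypothesis (W.conductorNorm ℤ) K)
    (p : ℕ) [hp : Fact p.Prime] (hp2 : p ≠ 2)
    (htower : ∀ n : ℕ, W.HasSurjectiveModNGaloisRep (p ^ n : ℕ))
    (c : K ≃ₐ[ℚ] K) (hc : c ≠ 1) (hcc : c * c = 1)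
    (hmult : ∀ v : HeightOneSpectrum (𝓞 ℚ), W.HasMultiplicativeReductionAt v →
      ¬ p ∣ W.ordMinimalDiscriminant v)
    (hadd : ∀ v : HeightOneSpectrum (𝓞 ℚ), W.HasAdditiveReductionAt v → p ≠ 3 ∨
      (W.kodairaSymbolAt v ≠ KodairaSymbol.IV ∧ W.kodairaSymbolAt v ≠ KodairaSymbol.IVstar))
    {n₁ : ℕ} (hn₁ : Squarefree n₁)
    (hk₁ : ∀ q ∈ n₁.primeFactors, Zhang2014.IsKolyvaginPrime (W.conductorNorm ℤ) W K p q)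
    (d₁ : KolyvaginHeegnerData Dt β ι n₁) (hne : d₁.kolyvaginClass hp.out 1 ≠ 0)
    (hrank : n₁.primeFactors.card ≤ W.mordellWeilRank)
    (hrank' : n₁.primeFactors.card + 1 ≤ (W.quadraticTwist (NumberField.discr K : ℚ)).mordellWeilRank) :
    W.shaCorank p = 0 ∧ W.mordellWeilRank = n₁.primeFactors.card ∧
      (W.quadraticTwist (NumberField.discr K : ℚ)).shaCorank p = 0 ∧
      (W.quadraticTwist (NumberField.discr K : ℚ)).mordellWeilRank = n₁.primeFactors.card + 1 ∧
      Nat.card ↥(AddSubgroup.torsionBy W.toAffine.Point ((p ^ 1 : ℕ) : ℤ)) = 1 ∧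
      W.sha ⊓ AddSubgroup.torsionBy W.galH1 ((p ^ 1 : ℕ) : ℤ) = ⊥ ∧
      Nat.card ↥(selmerGroup W ((p ^ 1 : ℕ) : ℤ)) = p ^ n₁.primeFactors.card ∧
      (W.quadraticTwist (NumberField.discr K : ℚ)).sha ⊓
          AddSubgroup.torsionBy (W.quadraticTwist (NumberField.discr K : ℚ)).galH1 ((p ^ 1 : ℕ) : ℤ) = ⊥ ∧
      Nat.card ↥(selmerGroup (W.quadraticTwist (NumberField.discr K : ℚ)) ((p ^ 1 : ℕ) : ℤ)) =
        p ^ (n₁.primeFactors.card + 1) :=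
  shaCorank_eq_zero_of_kolyvaginClass_ne_zero_of_twist_rank_of_datum_of_hfin h372 hcm hK hD3 hD4 hH p
    hp2 htower c hc hcc
    (fun _n hn hk d v hv ↦ kolyvaginClass_mem_selmerLocalKer_finite_one_of_kodairaNeron hK hD3 hD4 hH
      hp2 (by simpa only [pow_one] using htower 1) Dt β ι hmult hadd hn hk d v hv)
    hn₁ hk₁ d₁ hne hrank hrank'

/-- **THE DOOR OF A DATUM ON THE SECOND SIGN IN GENERAL, modulo (γ) + F1** (F1 =
`Gross1991_heegnerPoint_sub_ratTorsion_mem_E0`, [GZ86 III (3.1)] as Gross 1991 §6 uses it; cite-only).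
CONDITIONAL on (γ) + F1; per-curve; BSD is not proved by it. [cite: Kolyvagin1991MathAnn, Thm. 2.3]
[cite: GrossLMS1991, Prop. 3.7 (2), Prop. 6.2 (1), §10] [cite: GrossZagier1986, III (3.1)] -/
theorem shaCorank_eq_zero_of_kolyvaginClass_ne_zero_of_twist_rank_of_datum_gross1991E0
    (h372 : GrossLMS1991.prop37_2_frobeniusCongruence)
    (hE0 : Gross1991_heegnerPoint_sub_ratTorsion_mem_E0)
    (hcm : ¬ W.HasCM) (hK : IsImaginaryQuadratic K) (hD3 : NumberField.discr K ≠ -3)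
    (hD4 : NumberField.discr K ≠ -4) (hH : SatisfiesHeegnerHypothesis (W.conductorNorm ℤ) K)
    (p : ℕ) [hp : Fact p.Prime] (hp2 : p ≠ 2)
    (htower : ∀ n : ℕ, W.HasSurjectiveModNGaloisRep (p ^ n : ℕ))
    (c : K ≃ₐ[ℚ] K) (hc : c ≠ 1) (hcc : c * c = 1)
    {n₁ : ℕ} (hn₁ : Squarefree n₁)
    (hk₁ : ∀ q ∈ n₁.primeFactors, Zhang2014.IsKolyvaginPrime (W.conductorNorm ℤ) W K p q)
    (d₁ : KolyvaginHeegnerData Dt β ι n₁) (hne : d₁.kolyvaginClass hp.out 1 ≠ 0)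
    (hrank : n₁.primeFactors.card ≤ W.mordellWeilRank)
    (hrank' : n₁.primeFactors.card + 1 ≤ (W.quadraticTwist (NumberField.discr K : ℚ)).mordellWeilRank) :
    W.shaCorank p = 0 ∧ W.mordellWeilRank = n₁.primeFactors.card ∧
      (W.quadraticTwist (NumberField.discr K : ℚ)).shaCorank p = 0 ∧
      (W.quadraticTwist (NumberField.discr K : ℚ)).mordellWeilRank = n₁.primeFactors.card + 1 ∧
      Nat.card ↥(AddSubgroup.torsionBy W.toAffine.Point ((p ^ 1 : ℕ) : ℤ)) = 1 ∧
      W.sha ⊓ AddSubgroup.torsionBy W.galH1 ((p ^ 1 : ℕ) : ℤ) = ⊥ ∧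
      Nat.card ↥(selmerGroup W ((p ^ 1 : ℕ) : ℤ)) = p ^ n₁.primeFactors.card ∧
      (W.quadraticTwist (NumberField.discr K : ℚ)).sha ⊓
          AddSubgroup.torsionBy (W.quadraticTwist (NumberField.discr K : ℚ)).galH1 ((p ^ 1 : ℕ) : ℤ) = ⊥ ∧
      Nat.card ↥(selmerGroup (W.quadraticTwist (NumberField.discr K : ℚ)) ((p ^ 1 : ℕ) : ℤ)) =
        p ^ (n₁.primeFactors.card + 1) :=
  shaCorank_eq_zero_of_kolyvaginClass_ne_zero_of_twist_rank_of_datum_of_hfin h372 hcm hK hD3 hD4 hH p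
    hp2 htower c hc hcc
    (fun _n hn hk d v hv ↦ kolyvaginClass_mem_selmerLocalKer_finite_one_of_gross1991E0 hE0 hcm hK hD3
      hD4 hH hp2 (by simpa only [pow_one] using htower 1) Dt β ι hn hk d v hv)
    hn₁ hk₁ d₁ hne hrank hrank'

end Datum

end Summit.BirchSwinnertonDyer.BirchSwinnertonDyer.Theorems.KolyvaginDepthDoor

end
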